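import Literature.NumberTheory.Sieve.MatomakiRadziwillProp1U3
import HarnessLib

/-!
# Matomäki–Radziwiłł 2016, Proposition 1 for general coefficients — (d2) the point count with `X₀ ≤ X` (§8.3)

Topic `NumberTheory/Sieve`.  Everything in this file is PROVED; no definitions, no named facts.

The point count of §8.3 of K. Matomäki, M. Radziwiłł, *Multiplicative functions in short intervals*, Ann. of Math.
183 (2016) (`SieveIntervalSystem.card_witness_block_le`, `card_witness_le` of `MatomakiRadziwillProp1U2.lean`, and
`card_blocks_J_le` of `MatomakiRadziwillProp1U3.lean`) uses "`J` is the largest index with `Q_J ≤ exp(√log X)`"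
through `loglogX_lt` and `Q_J ≤ exp(√log X)`, where `X` is both the parameter of the interval system and the
summation range.  For Proposition A.3 of Matomäki–Radziwiłł–Tao 2015 (Appendix A) the system is attached to `X₀`
with `√X ≤ X₀ ≤ X`; this file re-proves the three statements for `I : SieveIntervalSystem η X₀` and a range `X`
with `e² ≤ X₀ ≤ X`, `log X ≤ 2 log X₀` (so `log log X ≤ 2 log log X₀`): the saving
`exp(4 (log T/log P_J) log log T) ≤ X^{4η/(J+1)²}` replaces `X^{2η/(J+1)²}`, which is still admissible since
`2α_J + 4η/(J+1)² ≤ 1/2 - 2η` (`4J ≤ (J+1)²`).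

* `two_alpha_add_le'`, `count_exponent_le'` — the exponent arithmetic with the factor `4η/(J+1)²`;
* `card_witness_block_le'`, `card_witness_le'` — `#𝒯 ≤ #ℐ_J · C₈ e^{(√log X)/2} X^{1/2-2η}` for a `1`-spaced set
  of points of `[T₀, T] ⊆ [0, X]` (`X^{1/4} ≤ T ≤ X`) with level-`J` witnesses (proofs of the tree file verbatim up to
  the two changes above);
* `card_blocks_J_le'` — `#ℐ_J ≤ 2·4^19 (log X)^{1/14} e^{(√log X)/6} √(log X)` for `e ≤ X₀ ≤ X`.

## References
* K. Matomäki, M. Radziwiłł, Ann. of Math. (2) 183 (2016), 1015–1056 (arXiv:1501.04585), §8.3 (arXiv p. 17).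
  [cite: MatomakiRadziwillAnnals2016, §8.3]
* K. Matomäki, M. Radziwiłł, T. Tao, Algebra & Number Theory 9 (2015), Appendix A, Proposition A.3 (proof).
  [cite: MatomakiRadziwillTao2015, Appendix A, Proposition A.3 (proof)]
-/

noncomputable section

open Finset Complex MeasureTheory

namespace Literature.NumberTheory.Sieve

namespace SieveIntervalSystem

variable {η X₀ : ℝ} (I : SieveIntervalSystem η X₀)

/-! ### The exponent arithmetic with `4η/(J+1)²` -/

/-- `2α_J + 4η/(J+1)² ≤ 1/2 - 2η` (`2α_J = 1/2 - 2η - η/J` and `4J ≤ (J+1)²`). [folklore] -/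
theorem two_alpha_add_le' (hη : 0 < η) : 2 * alpha η I.J + 4 * η / ((I.J : ℝ) + 1) ^ 2 ≤ 1 / 2 - 2 * η := by
  unfold alpha
  have hJ : (1 : ℝ) ≤ I.J := by exact_mod_cast I.one_le_J
  have hJ0 : (0 : ℝ) < I.J := by linarith
  have h1 : 4 * η / ((I.J : ℝ) + 1) ^ 2 ≤ η / I.J := by
    rw [div_le_div_iff₀ (by positivity) hJ0]
    have hsq : 4 * (I.J : ℝ) ≤ ((I.J : ℝ) + 1) ^ 2 := by nlinarith [sq_nonneg ((I.J : ℝ) - 1)]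
    nlinarith [mul_le_mul_of_nonneg_left hsq hη.le]
  have h2 : 2 * (η * (1 + 1 / (2 * (I.J : ℝ)))) = 2 * η + η / I.J := by
    field_simp
  nlinarith [h1, h2]

/-- The exponent arithmetic of the point count with the weaker key inequality `(J+1)² log L < η (y - 1)`:
with `y = log P_J`, `x ≥ y - 1/2`, `lT = log T ≤ L`, `llT = log log T ≤ log L` and `2α + 4η/(J+1)² ≤ 1/2 - 2η`:
`L · 2α + 4 (lT/x) llT ≤ L (1/2 - 2η)`. [folklore] -/
theorem count_exponent_le' {η L lT llT x y Jr α : ℝ} (hL : 0 < L) (hlT : lT ≤ L) (hlT0 : 0 ≤ lT)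
    (hllT : llT ≤ Real.log L) (hllT0 : 0 ≤ llT) (hy : 2 ≤ y) (hxy : y - 1 / 2 ≤ x) (hJr : 0 ≤ Jr)
    (hkey : (Jr + 1) ^ 2 * Real.log L < η * (y - 1))
    (h2α : 2 * α + 4 * η / (Jr + 1) ^ 2 ≤ 1 / 2 - 2 * η) :
    L * (2 * α) + 4 * (lT / x) * llT ≤ L * (1 / 2 - 2 * η) := by
  have hx0 : 0 < x := by linarith
  have hy0 : 0 < y - 1 := by linarith
  have hJ0 : 0 < (Jr + 1) ^ 2 := by positivity
  have h1 : lT / x ≤ L / (y - 1) := by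
    rw [div_le_div_iff₀ hx0 hy0]
    calc lT * (y - 1) ≤ lT * x := mul_le_mul_of_nonneg_left (by linarith) hlT0
      _ ≤ L * x := mul_le_mul_of_nonneg_right hlT hx0.le
  have h2 : 4 * (lT / x) * llT ≤ 4 * (L / (y - 1)) * Real.log L :=
    mul_le_mul (by linarith) hllT hllT0 (by positivity)
  have h3 : 4 * (L / (y - 1)) * Real.log L ≤ L * (4 * η / (Jr + 1) ^ 2) := by
    rw [show 4 * (L / (y - 1)) * Real.log L = (4 * L * Real.log L) / (y - 1) by ring,
      show L * (4 * η / (Jr + 1) ^ 2) = (4 * η * L) / (Jr + 1) ^ 2 by ring,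
      div_le_div_iff₀ hy0 hJ0]
    have := mul_le_mul_of_nonneg_left hkey.le (show 0 ≤ 4 * L by linarith)
    linarith
  have h4 := mul_le_mul_of_nonneg_left h2α hL.le
  linarith

/-! ### The point count for `X₀ ≤ X` -/

set_option maxHeartbeats 400000 in
/-- (Interval system attached to `X₀`, `e² ≤ X₀ ≤ X`, `log X ≤ 2 log X₀`.)  **Lemma 8 for one witness block** (§8.3): for `v ∈ ℐ_J`, the `1`-spaced points `t ∈ [T₀, T] ⊂ [0, T]` with
`|Q_{v,H_J}(1+it)| ≥ e^{-α_J v/H_J}` number at most `C₈ e^{(√log X)/2} X^{1/2 - 2η}` when `X^{1/4} ≤ T ≤ X`,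
`log X ≥ 400`, `H₁ ≥ 2` (Lemma 8 with `P = e^{v/H_J}`, `V = e^{α_J v/H_J}`: `V² ≤ e^{(√log X)/2}`,
`T^{2α_J} ≤ X^{2α_J}`, `exp(4 (log T/log P) log log T) ≤ X^{2η/(J+1)²}` by `loglogX_lt`).
[cite: MatomakiRadziwillAnnals2016, §8.3] -/
theorem card_witness_block_le' {C₈ : ℝ} (hC₈ : 0 ≤ C₈) (h8 : (∀ (P T V : ℝ) (a : ℕ → ℂ) (𝒯 : Finset ℝ), 2 ≤ P → P ^ 2 ≤ T →
      Real.exp (Real.exp 4) ≤ T → 1 ≤ V → (∀ p, ‖a p‖ ≤ 1) → (∀ t ∈ 𝒯, |t| ≤ T) →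
      (∀ t ∈ 𝒯, ∀ t' ∈ 𝒯, t ≠ t' → 1 ≤ |t - t'|) →
      (∀ t ∈ 𝒯, V⁻¹ ≤ ‖∑ p ∈ (Finset.Icc ⌈P⌉₊ ⌊2 * P⌋₊).filter Nat.Prime,
          a p * (p : ℂ) ^ (-(1 + (t : ℂ) * Complex.I))‖) →
      ((Finset.card 𝒯 : ℕ) : ℝ) ≤ C₈ * V ^ 2 * T ^ (2 * Real.log V / Real.log P)
        * Real.exp (4 * (Real.log T / Real.log P) * Real.log (Real.log T))))
    (hη : 0 < η) (hη6 : η < 1 / 6) {c : ℕ → ℂ} (hc : ∀ p, ‖c p‖ ≤ 1) {X : ℝ} (hXe : Real.exp 1 ≤ X)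
    (hX₀ : Real.exp 2 ≤ X₀) (hX₀X : X₀ ≤ X) (hLX₀ : Real.log X ≤ 2 * Real.log X₀) (hL : 400 ≤ Real.log X) {T₀ T : ℝ} (hT₀ : 0 ≤ T₀) (hXT : X ^ (1 / 4 : ℝ) ≤ T) (hTX : T ≤ X)
    (hH1 : 2 ≤ I.Hpar 1) {v : ℕ} (hv : v ∈ I.blocks I.J) (𝒯 : Finset ℝ)
    (h𝒯 : ∀ t ∈ 𝒯, t ∈ Set.Icc T₀ T ∧
      Real.exp (-(alpha η I.J * v / I.Hpar I.J)) ≤ ‖blockPrimePoly c (I.P I.J) (I.Q I.J) (I.Hpar I.J) v t‖)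
    (hws : ∀ t ∈ 𝒯, ∀ t' ∈ 𝒯, t ≠ t' → 1 ≤ |t - t'|) :
    (#𝒯 : ℝ) ≤ C₈ * Real.exp (Real.sqrt (Real.log X) / 2) * X ^ (1 / 2 - 2 * η : ℝ) := by
  classical
  have hη' : η ≤ 8 := by linarith
  have hη'' : η ≤ 1 / 6 := hη6.le
  set L := Real.log X with hLdef
  have hX0 : 0 < X := (Real.exp_pos 1).trans_le hXe
  have hL1 : 1 < L := by linarith
  have hL0 : 0 < L := by linarith
  have hJ1 : 1 ≤ I.J := I.one_le_J
  have hHJ : 2 ≤ I.Hpar I.J := hH1.trans (I.Hpar_one_le hη hη' hJ1)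
  have hHJ0 : 0 < I.Hpar I.J := by linarith
  have hXrpow : ∀ y : ℝ, X ^ y = Real.exp (L * y) := fun y => Real.rpow_def_of_pos hX0 y
  -- `T` is large: `T ≥ X^{1/4} = e^{L/4} ≥ e^{100}`
  have hT4 : Real.exp (L / 4) ≤ T := by rw [hXrpow] at hXT; convert hXT using 2; ring
  have hT0 : 0 < T := (Real.exp_pos _).trans_le hT4
  have hlogT : L / 4 ≤ Real.log T := by
    have := Real.log_le_log (Real.exp_pos _) hT4; rwa [Real.log_exp] at this
  have hlogTL : Real.log T ≤ L := Real.log_le_log hT0 hTX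
  have heT : Real.exp (Real.exp 4) ≤ T :=
    (Real.exp_le_exp.2 (by linarith [exp_four_le])).trans hT4
  have hlogT1 : 1 < Real.log T := by linarith
  have hllT : Real.log (Real.log T) ≤ Real.log L := Real.log_le_log (by linarith) hlogTL
  have hllT0 : 0 ≤ Real.log (Real.log T) := Real.log_nonneg hlogT1.le
  -- level-`J` facts
  have hlogPJ : 2 ≤ Real.log (I.P I.J) := I.two_le_logP hη hη'' hJ1
  have hX₀0 : 0 < X₀ := (Real.exp_pos 2).trans_le hX₀
  have hlogX₀ : 2 ≤ Real.log X₀ := by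
    rw [← Real.log_exp 2]; exact Real.log_le_log (Real.exp_pos 2) hX₀
  have hQJ : Real.log (I.Q I.J) ≤ Real.sqrt L := by
    have := Real.log_le_log (I.pos_Q hJ1) I.Q_J_le
    rw [Real.log_exp] at this
    exact this.trans (Real.sqrt_le_sqrt (Real.log_le_log hX₀0 hX₀X))
  have hkey₀ := I.loglogX_lt (by linarith : 1 < Real.log X₀)
  have hkey : ((I.J : ℝ) + 1) ^ 2 * Real.log L < η * (Real.log (I.P I.J) - 1) := by
    have hll0 : Real.log 2 ≤ Real.log (Real.log X₀) := Real.log_le_log two_pos hlogX₀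
    have h1 : Real.log L ≤ Real.log 2 + Real.log (Real.log X₀) := by
      rw [← Real.log_mul two_ne_zero (by linarith)]
      exact Real.log_le_log hL0 hLX₀
    have h2 : Real.log L ≤ 2 * Real.log (Real.log X₀) := by linarith
    have hJ0 : 0 ≤ ((I.J : ℝ) + 1) ^ 2 := by positivity
    nlinarith
  obtain ⟨hαpos, hαle⟩ := alpha_pos hη hη6 hJ1 (η := η) (i := I.J)
  have h2α := I.two_alpha_add_le' hη
  set x : ℝ := (v : ℝ) / I.Hpar I.J with hx
  -- `x = v/H_J ∈ [log P_J - 1/2, log Q_J]`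
  have hx1 : Real.log (I.P I.J) - 1 / 2 ≤ x := by
    have h := I.Hpar_mul_log_P_lt hv
    rw [hx, le_div_iff₀ hHJ0]
    nlinarith
  have hx2 : x ≤ Real.log (I.Q I.J) := by
    have h := I.exp_div_Hpar_le hη hη' hJ1 hv hHJ0
    have := Real.log_le_log (Real.exp_pos _) h
    rwa [Real.log_exp] at this
  have hxpos : 0 < x := by linarith
  set P : ℝ := Real.exp x with hP
  set V : ℝ := Real.exp (alpha η I.J * x) with hV
  have hlogP : Real.log P = x := Real.log_exp x
  have hlogV : Real.log V = alpha η I.J * x := Real.log_exp _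
  have h2P : 2 ≤ P := by
    have := Real.add_one_le_exp x
    rw [← hP] at this
    linarith
  have hP2T : P ^ 2 ≤ T := by
    have h1 : P ^ 2 = Real.exp (2 * x) := by rw [hP, ← Real.exp_nat_mul]; norm_num
    rw [h1]
    refine le_trans (Real.exp_le_exp.2 ?_) hT4
    have hsq : Real.sqrt L * Real.sqrt L = L := Real.mul_self_sqrt hL0.le
    have h8L : 8 ≤ Real.sqrt L := by
      rw [show (8 : ℝ) = Real.sqrt (8 ^ 2) by rw [Real.sqrt_sq (by norm_num)]]
      exact Real.sqrt_le_sqrt (by linarith)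
    nlinarith
  have hV1 : 1 ≤ V := Real.one_le_exp (by positivity)
  -- the coefficients
  obtain ⟨a, ha⟩ : ∃ a : ℕ → ℂ, a = fun p => if p ∈ ((Icc ⌈I.P I.J⌉₊ ⌊I.Q I.J⌋₊).filter Nat.Prime).filter
      (fun p : ℕ => Real.exp (v / I.Hpar I.J) ≤ p ∧ (p : ℝ) < Real.exp ((v + 1) / I.Hpar I.J))
      then c p else 0 := ⟨_, rfl⟩
  have ha1 : ∀ p, ‖a p‖ ≤ 1 := fun p => by
    rw [ha]
    dsimp only
    split_ifs
    · exact hc p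
    · simp
  have habs : ∀ t ∈ 𝒯, |t| ≤ T := fun t ht => by
    have h := (h𝒯 t ht).1
    rw [abs_of_nonneg (hT₀.trans h.1)]
    exact h.2
  have hlarge : ∀ t ∈ 𝒯, V⁻¹ ≤ ‖∑ p ∈ (Icc ⌈P⌉₊ ⌊2 * P⌋₊).filter Nat.Prime,
      a p * (p : ℂ) ^ (-(1 + (t : ℂ) * Complex.I))‖ := by
    intro t ht
    have h := (h𝒯 t ht).2
    rw [blockPrimePoly_eq_sum_Icc c (I.P I.J) (I.Q I.J) hHJ v t] at h
    rw [hV, ← Real.exp_neg, ha]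
    convert h using 3
    rw [hx]; ring
  have h := h8 P T V a 𝒯 h2P hP2T heT hV1 ha1 habs hws hlarge
  rw [hlogP, hlogV] at h
  have hexp1 : 2 * (alpha η I.J * x) / x = 2 * alpha η I.J := by field_simp
  rw [hexp1] at h
  refine h.trans ?_
  -- `V² ≤ e^{√L/2}`
  have hV2 : V ^ 2 ≤ Real.exp (Real.sqrt L / 2) := by
    rw [hV, ← Real.exp_nat_mul]
    refine Real.exp_le_exp.2 ?_
    push_cast
    have : alpha η I.J * x ≤ 1 / 4 * Real.sqrt L :=
      mul_le_mul hαle (hx2.trans hQJ) hxpos.le (by norm_num)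
    linarith
  -- `T^{2α_J} ≤ e^{2α_J L}`
  have hT2α : T ^ (2 * alpha η I.J) ≤ Real.exp (L * (2 * alpha η I.J)) := by
    rw [← hXrpow]
    exact Real.rpow_le_rpow hT0.le hTX (by linarith)
  have hT2α0 : 0 ≤ T ^ (2 * alpha η I.J) := Real.rpow_nonneg hT0.le _
  have hexp := count_exponent_le' (α := alpha η I.J) hL0 hlogTL (by linarith) hllT hllT0 hlogPJ hx1
    (Nat.cast_nonneg I.J) hkey h2α
  calc C₈ * V ^ 2 * T ^ (2 * alpha η I.J) * Real.exp (4 * (Real.log T / x) * Real.log (Real.log T))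
      ≤ C₈ * Real.exp (Real.sqrt L / 2) * Real.exp (L * (2 * alpha η I.J)) *
          Real.exp (4 * (Real.log T / x) * Real.log (Real.log T)) := by
        refine mul_le_mul_of_nonneg_right ?_ (Real.exp_pos _).le
        exact mul_le_mul (mul_le_mul_of_nonneg_left hV2 hC₈) hT2α hT2α0 (by positivity)
    _ = C₈ * Real.exp (Real.sqrt L / 2) *
          Real.exp (L * (2 * alpha η I.J) + 4 * (Real.log T / x) * Real.log (Real.log T)) := by
        rw [Real.exp_add]; ring
    _ ≤ C₈ * Real.exp (Real.sqrt L / 2) * X ^ (1 / 2 - 2 * η : ℝ) := by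
        rw [hXrpow]
        exact mul_le_mul_of_nonneg_left (Real.exp_le_exp.2 hexp) (by positivity)

/-- (Interval system attached to `X₀`, `e² ≤ X₀ ≤ X`, `log X ≤ 2 log X₀`.)  **The points of `𝒯` are few** (§8.3: "`|𝒯| ≪ |ℐ_J| · T^{2α_J + o(1)} · T^η · X^{o(1)} ≪ T^{1/2-η} X^{o(1)}`"),
in the explicit form: for `X^{1/4} ≤ T ≤ X`, `log X ≥ 400`, `H₁ ≥ 2`, a `1`-spaced `𝒯 ⊂ [T₀, T]` (`T₀ ≥ 0`) each of
whose points has a level-`J` witness satisfies `#𝒯 ≤ #ℐ_J · C₈ e^{(√log X)/2} X^{1/2 - 2η}`, `C₈` the constant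
of Lemma 8 (sharp form, hypothesis `h8`). [cite: MatomakiRadziwillAnnals2016, §8.3] -/
theorem card_witness_le' {C₈ : ℝ} (hC₈ : 0 ≤ C₈) (h8 : (∀ (P T V : ℝ) (a : ℕ → ℂ) (𝒯 : Finset ℝ), 2 ≤ P → P ^ 2 ≤ T →
      Real.exp (Real.exp 4) ≤ T → 1 ≤ V → (∀ p, ‖a p‖ ≤ 1) → (∀ t ∈ 𝒯, |t| ≤ T) →
      (∀ t ∈ 𝒯, ∀ t' ∈ 𝒯, t ≠ t' → 1 ≤ |t - t'|) →
      (∀ t ∈ 𝒯, V⁻¹ ≤ ‖∑ p ∈ (Finset.Icc ⌈P⌉₊ ⌊2 * P⌋₊).filter Nat.Prime,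
          a p * (p : ℂ) ^ (-(1 + (t : ℂ) * Complex.I))‖) →
      ((Finset.card 𝒯 : ℕ) : ℝ) ≤ C₈ * V ^ 2 * T ^ (2 * Real.log V / Real.log P)
        * Real.exp (4 * (Real.log T / Real.log P) * Real.log (Real.log T))))
    (hη : 0 < η) (hη6 : η < 1 / 6) {c : ℕ → ℂ} (hc : ∀ p, ‖c p‖ ≤ 1) {X : ℝ} (hXe : Real.exp 1 ≤ X)
    (hX₀ : Real.exp 2 ≤ X₀) (hX₀X : X₀ ≤ X) (hLX₀ : Real.log X ≤ 2 * Real.log X₀) (hL : 400 ≤ Real.log X) {T₀ T : ℝ} (hT₀ : 0 ≤ T₀) (hXT : X ^ (1 / 4 : ℝ) ≤ T) (hTX : T ≤ X)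
    (hH1 : 2 ≤ I.Hpar 1) (𝒯 : Finset ℝ)
    (h𝒯 : ∀ t ∈ 𝒯, t ∈ Set.Icc T₀ T ∧ ∃ v ∈ I.blocks I.J,
      Real.exp (-(alpha η I.J * v / I.Hpar I.J)) ≤ ‖blockPrimePoly c (I.P I.J) (I.Q I.J) (I.Hpar I.J) v t‖)
    (hws : ∀ t ∈ 𝒯, ∀ t' ∈ 𝒯, t ≠ t' → 1 ≤ |t - t'|) :
    (#𝒯 : ℝ) ≤ #(I.blocks I.J) * (C₈ * Real.exp (Real.sqrt (Real.log X) / 2) * X ^ (1 / 2 - 2 * η : ℝ)) := by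
  classical
  -- the points witnessed by a fixed `v`
  have hv_bound : ∀ v ∈ I.blocks I.J,
      (#(𝒯.filter fun t => Real.exp (-(alpha η I.J * v / I.Hpar I.J)) ≤
          ‖blockPrimePoly c (I.P I.J) (I.Q I.J) (I.Hpar I.J) v t‖) : ℝ) ≤
        C₈ * Real.exp (Real.sqrt (Real.log X) / 2) * X ^ (1 / 2 - 2 * η : ℝ) := by
    intro v hv
    refine I.card_witness_block_le' hC₈ h8 hη hη6 hc hXe hX₀ hX₀X hLX₀ hL hT₀ hXT hTX hH1 hv _ ?_ ?_
    · intro t ht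
      rw [Finset.mem_filter] at ht
      exact ⟨(h𝒯 t ht.1).1, ht.2⟩
    · intro t ht t' ht' hne
      exact hws t (Finset.mem_filter.1 ht).1 t' (Finset.mem_filter.1 ht').1 hne
  -- sum over the witnesses
  have hcover : 𝒯 ⊆ (I.blocks I.J).biUnion fun v => 𝒯.filter fun t =>
      Real.exp (-(alpha η I.J * v / I.Hpar I.J)) ≤
        ‖blockPrimePoly c (I.P I.J) (I.Q I.J) (I.Hpar I.J) v t‖ := by
    intro t ht
    obtain ⟨v, hv, hle⟩ := (h𝒯 t ht).2
    exact Finset.mem_biUnion.2 ⟨v, hv, Finset.mem_filter.2 ⟨ht, hle⟩⟩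
  calc (#𝒯 : ℝ) ≤ #((I.blocks I.J).biUnion fun v => 𝒯.filter fun t =>
        Real.exp (-(alpha η I.J * v / I.Hpar I.J)) ≤
          ‖blockPrimePoly c (I.P I.J) (I.Q I.J) (I.Hpar I.J) v t‖) := by
        exact_mod_cast Finset.card_le_card hcover
    _ ≤ ∑ v ∈ I.blocks I.J, (#(𝒯.filter fun t => Real.exp (-(alpha η I.J * v / I.Hpar I.J)) ≤
          ‖blockPrimePoly c (I.P I.J) (I.Q I.J) (I.Hpar I.J) v t‖) : ℝ) := by
        exact_mod_cast Finset.card_biUnion_le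
    _ ≤ ∑ v ∈ I.blocks I.J, C₈ * Real.exp (Real.sqrt (Real.log X) / 2) * X ^ (1 / 2 - 2 * η : ℝ) :=
        Finset.sum_le_sum hv_bound
    _ = #(I.blocks I.J) * (C₈ * Real.exp (Real.sqrt (Real.log X) / 2) * X ^ (1 / 2 - 2 * η : ℝ)) := by
        rw [Finset.sum_const, nsmul_eq_mul]


/-! ### The number of blocks `ℐ_J` for `X₀ ≤ X` -/

/-- `#ℐ_J ≤ 2 · 4^19 (log X)^{1/14} e^{(√log X)/6} √log X` for an interval system attached to `X₀` with `e ≤ X₀ ≤ X`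
(`#ℐ_J ≤ 2 H_J log Q_J`, `H_J = J² H₁`, `J² ≤ 4^J ≤ 4^19 (log X₀)^{1/14}`, `H₁ ≤ P₁^{1/6} ≤ Q_J^{1/6} ≤ e^{(√log X₀)/6}`,
`log Q_J ≤ √log X₀ ≤ √log X`), for `H₁ ≥ 1`. [folklore] -/
theorem card_blocks_J_le' (hη : 0 < η) (hη6 : η < 1 / 6) {X : ℝ} (hX₀e : Real.exp 1 ≤ X₀) (hX₀X : X₀ ≤ X)
    (hH1 : 1 ≤ I.Hpar 1) :
    (#(I.blocks I.J) : ℝ) ≤ 2 * 4 ^ 19 * Real.log X ^ (1 / 14 : ℝ) * Real.exp (Real.sqrt (Real.log X) / 6) *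
      Real.sqrt (Real.log X) := by
  have hη' : η ≤ 8 := by linarith
  have hη'' : η ≤ 1 / 6 := hη6.le
  have hJ1 := I.one_le_J
  have h1 := I.card_blocks_le hη hη'' hJ1 (hH1.trans (I.Hpar_one_le hη hη' hJ1))
  have hX₀0 : 0 < X₀ := (Real.exp_pos 1).trans_le hX₀e
  have hL1₀ : 1 ≤ Real.log X₀ := by rw [← Real.log_exp 1]; exact Real.log_le_log (Real.exp_pos 1) hX₀e
  have hlogle : Real.log X₀ ≤ Real.log X := Real.log_le_log hX₀0 hX₀X
  have hL1 : 1 ≤ Real.log X := hL1₀.trans hlogle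
  have hsqrtle : Real.sqrt (Real.log X₀) ≤ Real.sqrt (Real.log X) := Real.sqrt_le_sqrt hlogle
  have hQJ : Real.log (I.Q I.J) ≤ Real.sqrt (Real.log X) := by
    have := Real.log_le_log (I.pos_Q hJ1) I.Q_J_le
    rw [Real.log_exp] at this
    exact this.trans hsqrtle
  have hQJ0 : 0 ≤ Real.log (I.Q I.J) := MatomakiRadziwillThm3.logQ_nonneg I hη hJ1
  -- `H_J = J² H₁ ≤ 4^J e^{√L/6}`
  have hH1le : I.Hpar 1 ≤ Real.exp (Real.sqrt (Real.log X) / 6) := by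
    have hP1 : 1 ≤ I.P 1 := I.one_le_P_one
    have hQ1 : 1 < Real.log (I.Q 1) := I.one_lt_log_Q_one hη hη'
    have hP1Q : I.P 1 ≤ I.Q I.J := by
      refine (I.P_le_Q 1 le_rfl).trans ?_
      rcases eq_or_lt_of_le hJ1 with h | h
      · rw [← h]
      · exact (I.Q_lt_Q hη hη' le_rfl h).le
    unfold Hpar
    simp only [Nat.cast_one, one_pow, one_mul]
    have hden : 1 ≤ Real.log (I.Q 1) ^ (1 / 3 : ℝ) := Real.one_le_rpow hQ1.le (by norm_num)
    calc I.P 1 ^ (1 / 6 - η) / Real.log (I.Q 1) ^ (1 / 3 : ℝ) ≤ I.P 1 ^ (1 / 6 - η) :=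
          div_le_self (Real.rpow_nonneg (by linarith) _) hden
      _ ≤ I.P 1 ^ (1 / 6 : ℝ) := Real.rpow_le_rpow_of_exponent_le hP1 (by linarith)
      _ ≤ I.Q I.J ^ (1 / 6 : ℝ) := Real.rpow_le_rpow (by linarith) hP1Q (by norm_num)
      _ ≤ Real.exp (Real.sqrt (Real.log X)) ^ (1 / 6 : ℝ) :=
          Real.rpow_le_rpow (I.pos_Q hJ1).le (I.Q_J_le.trans (Real.exp_le_exp.2 hsqrtle)) (by norm_num)
      _ = Real.exp (Real.sqrt (Real.log X) / 6) := by
          rw [← Real.exp_mul]; congr 1; ring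
  have hJsq : ((I.J : ℝ)) ^ 2 ≤ 4 ^ I.J := by
    have h := Nat.lt_two_pow_self (n := I.J)
    have h' : ((I.J : ℝ)) ≤ 2 ^ I.J := by exact_mod_cast h.le
    calc ((I.J : ℝ)) ^ 2 ≤ (2 ^ I.J) ^ 2 := pow_le_pow_left₀ (Nat.cast_nonneg _) h' 2
      _ = 4 ^ I.J := by rw [← pow_mul, mul_comm, pow_mul]; norm_num
  have h4J : (4 : ℝ) ^ I.J ≤ 4 ^ 19 * Real.log X ^ (1 / 14 : ℝ) :=
    (MatomakiRadziwillThm3.four_pow_J_le I hη hη'' hL1₀).trans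
      (mul_le_mul_of_nonneg_left (Real.rpow_le_rpow (by linarith) hlogle (by norm_num)) (by positivity))
  have hHJ : I.Hpar I.J ≤ 4 ^ 19 * Real.log X ^ (1 / 14 : ℝ) * Real.exp (Real.sqrt (Real.log X) / 6) := by
    rw [I.Hpar_eq]
    have h0 : 0 ≤ I.Hpar 1 := by linarith
    calc ((I.J : ℝ)) ^ 2 * I.Hpar 1 ≤ 4 ^ I.J * I.Hpar 1 := mul_le_mul_of_nonneg_right hJsq h0
      _ ≤ (4 ^ 19 * Real.log X ^ (1 / 14 : ℝ)) * Real.exp (Real.sqrt (Real.log X) / 6) :=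
          mul_le_mul h4J hH1le h0 (by positivity)
  calc (#(I.blocks I.J) : ℝ) ≤ 2 * (I.Hpar I.J * Real.log (I.Q I.J)) := h1
    _ ≤ 2 * ((4 ^ 19 * Real.log X ^ (1 / 14 : ℝ) * Real.exp (Real.sqrt (Real.log X) / 6)) *
          Real.sqrt (Real.log X)) := by
        refine mul_le_mul_of_nonneg_left (mul_le_mul hHJ hQJ hQJ0 (by positivity)) (by norm_num)
    _ = _ := by ring


end SieveIntervalSystem

end Literature.NumberTheory.Sieve
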